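import Mathlib
import HarnessLib
import Literature.MathematicalPhysics.StatisticalMechanics.StepOperatorBABKM
import Literature.MathematicalPhysics.StatisticalMechanics.StepKernelBoundsABKM

/-!
# The operator `B_k^{(q)} = −Π₂ R^{(q)}_{k+1}(·)(B₀)` for the torus data with a step kernel BY
# PREDICATE: Lemma 10.6 and additivity, `q ∈ B_κ` ([ABKM19] Theorem 6.8 / Lemma 10.6)

`StepOperatorBABKM` proves Lemma 10.6 (`‖B_k K‖_{k+1,0} ≤ L^d C_{8.7} A_𝒫 A^{−1} ‖K‖_k^{(A)}`) and
the additivity of `B_k` for the step data with kernel EQUAL to the weight kernel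
(`hD𝒞 : D.𝒞 = 𝒞_{k+1}`, i.e. `q = 0`).  In the fine-tuning argument of [ABKM19] Ch. 12 the maps
`T_k^{(q)}`, `q ∈ B_κ`, are all measured in the norms of the `q = 0` weights while their step
integrates against `μ^{(q)}_{k+1}`; what the proof of Lemma 10.6 uses of the step kernel is exactly
the predicate `StepKernelBounds` of `StepKernelBoundsABKM` (integration property (w7′) with some
constant `A𝒫'`, and smoothness of `R_{k+1}K` from the subcriticality margin).  This file is the
`q`-twin of `StepOperatorBABKM` with the kernel equality replaced by the predicate:

* **`hamNorm_opB_abkm_le_of_stepKernelBounds`** — Lemma 10.6: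
  `‖B_k K‖_{k+1,0} ≤ L^d · C_{8.7} · C A𝒫' A^{−1}` for `StepKernelBounds W L k A𝒫' C₂ D.𝒞`;
* **`opBHomQ`**, `opBHomQ_apply` — `B_k` as an additive map `activitySpace P k →+ M_0` for such `D`.

The `q = 0` statements are recovered with `AbkmWeightBounds.stepKernelBounds`.
Everything is proved; no named fact.

## References
* S. Adams, S. Buchholz, R. Kotecký, S. Müller, arXiv:1910.13564, Lemma 10.6, Lemma 8.4, Theorem 6.8
  (`B_k^{(q)}`), Lemma 7.7 [AdamsBuchholzKoteckyMuller2019].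
-/

noncomputable section

namespace Literature.MathematicalPhysics.StatisticalMechanics.GradientRG

open scoped BigOperators Classical MatrixOrder
open Finset Matrix MeasureTheory
open Literature.MathematicalPhysics.StatisticalMechanics.GradientFRD (cExt fourierCoeff mulMat)
open Literature.MathematicalPhysics.StatisticalMechanics.TorusPolymer
  (IsPolymer numBlocks blockOf thicken boxCorner isPolymer_blockOf card_blockOf)
open Literature.Barriers.CriticalPhenomena.LongRangePhi4.Polymer (IsConn)
open Literature.MathematicalPhysics.QuantumFieldTheory

variable {d M : ℕ} [NeZero M]

/-! ## Lemma 10.6 for the concrete data, step kernel by predicate -/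

/-- **[ABKM19] Lemma 10.6 for the torus data and a step kernel by predicate** (`q ∈ B_κ`): for
`d ≥ 3`, `L` odd, `L ≥ 2^{d+3} + 16R`, `M = L^N`, `k + 1 ≤ N`, `p + d ≤ M_ord ≤ R`, `r₀ ≥ 3`, `h > 0`,
a weight tower with the conclusions of Theorem 7.1, `A ≥ 1`, step data of scale `k` whose kernel
satisfies `StepKernelBounds W L k A𝒫' C₂ D.𝒞` (reference block `B_{x₀}`, base point the corner of
`B_{x₀}*`), and a local `C^{r₀}` activity with `‖K‖_k^{(A)} ≤ C`:
`‖B_k K‖_{k+1,0} ≤ L^d · C_{8.7} · C A𝒫' A^{−1}`. [cite: AdamsBuchholzKoteckyMuller2019, Lemma 10.6] -/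
theorem hamNorm_opB_abkm_le_of_stepKernelBounds {L N Mord R n p r₀ : ℕ}
    {θbar lam μ δ₁ δ₀ A𝒫 A𝒫' C₂ h A : ℝ}
    {𝒞 : ℕ → (Fin d → ZMod M) → ℝ} (hd : 3 ≤ d) (hLodd : Odd L) (hL : 2 ^ (d + 3) + 16 * R ≤ L)
    (hM : M = L ^ N) {k : ℕ} (hkN : k + 1 ≤ N) (hpM : p + d ≤ Mord) (hMR : Mord ≤ R)
    (hr₀ : 3 ≤ r₀)
    (hB : AbkmWeightBounds L N Mord R n θbar lam μ δ₁ δ₀ A𝒫 𝒞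
      (abkmWeightData L N Mord R θbar (schedDelta δ₀ δ₁ N) 𝒞))
    (hh : 0 < h) (hA : 1 ≤ A)
    (D : StepData d M)
    (hS : StepKernelBounds (abkmWeightData L N Mord R θbar (schedDelta δ₀ δ₁ N) 𝒞) L k A𝒫' C₂ D.𝒞)
    {x₀ : Fin d → ZMod M} (hB₀ : D.B₀ = blockOf (L ^ k) x₀)
    (hc₀ : D.c₀ = boxCorner (L ^ k) (starRad R L d k) x₀)
    {K : Finset (Fin d → ZMod M) → ((Fin d → ZMod M) → ℝ) → ℂ} {C : ℝ} (hC : 0 ≤ C)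
    (hK : WeakNormLE (abkmNormParams L N Mord R p r₀ h θbar A (schedDelta δ₀ δ₁ N) 𝒞) k K C)
    (hKd : ∀ X, ContDiff ℝ r₀ (K X))
    (hKloc : ∀ X, IsPolymer (L ^ k) X → IsConn X →
      IsGaugeLocal ((abkmNormParams L N Mord R p r₀ h θbar A (schedDelta δ₀ δ₁ N) 𝒞).gauge k X) (K X)) :
    hamNorm (fieldWt h L d (k + 1)) ((L : ℝ) ^ (k + 1)) (L ^ (d * (k + 1))) (opB D K) ≤
      (L : ℝ) ^ d * (pi2BoundConst d (((2 * R + 2 : ℕ) : ℝ) + ((d / 2 + 1 : ℕ) : ℝ)) *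
        (C * A𝒫' * A⁻¹)) := by
  set P := abkmNormParams L N Mord R p r₀ h θbar A (schedDelta δ₀ δ₁ N) 𝒞 with hP
  have h8 : 8 ≤ 2 ^ (d + 3) := by
    calc 8 = 2 ^ 3 := by norm_num
      _ ≤ 2 ^ (d + 3) := Nat.pow_le_pow_right (by norm_num) (by omega)
  have hL4 : 4 ≤ L := by omega
  have hL0 : (0 : ℝ) < L := by exact_mod_cast hLodd.pos
  have hpR : p ≤ R := by omega
  -- the torus at scale `k`
  obtain ⟨t, ht⟩ : ∃ t, N = k + t := ⟨N - k, by omega⟩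
  have hMt0 : M = L ^ k * L ^ t := by rw [← pow_add, ← ht]; exact hM
  have hMt : M = P.L ^ k * L ^ t := hMt0
  have htodd : Odd (L ^ t) := hLodd.pow
  -- weights of the two scales
  have h𝔥' : 0 < P.𝔥 (k + 1) := fieldWt_pos hh hL0 d (k + 1)
  have h𝔥k : 0 < P.𝔥 k := fieldWt_pos hh hL0 d k
  have hsucc : P.𝔥 (k + 1) = scaleRatio d L * P.𝔥 k := fieldWt_succ_nat hLodd.pos d k
  have h𝔥le : P.𝔥 (k + 1) ≤ P.𝔥 k := by
    rw [hsucc]; exact mul_le_of_le_one_left h𝔥k.le (scaleRatio_le_one hd hL4)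
  have hR : 0 < P.R k := by show (0 : ℝ) < (L : ℝ) ^ k; positivity
  have hRle : P.R k ≤ P.R (k + 1) := by
    show (L : ℝ) ^ k ≤ (L : ℝ) ^ (k + 1)
    exact pow_le_pow_right₀ (by exact_mod_cast hLodd.pos) (Nat.le_succ k)
  have hr₀' : 2 ≤ P.r₀ := by show 2 ≤ r₀; omega
  -- the box
  obtain ⟨hwrap0, hroom0⟩ := abkm_box_lt (d := d) hL hpR hkN
  have hwrap : 4 * ((P.L ^ k - 1) / 2 + P.rad k) < M := by
    show 4 * ((L ^ k - 1) / 2 + starRad R L d k) < M; rw [hM]; exact hwrap0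
  have hroom : ((2 * ((P.L ^ k - 1) / 2 + P.rad k) : ℕ) + (P.p : ℤ)) * 2 < M := by
    show ((2 * ((L ^ k - 1) / 2 + starRad R L d k) : ℕ) + (p : ℤ)) * 2 < (M : ℤ)
    rw [hM]; exact_mod_cast hroom0
  have hC₀ : (1 : ℝ) ≤ ((2 * R + 2 : ℕ) : ℝ) + ((d / 2 + 1 : ℕ) : ℝ) := by
    have : (1 : ℝ) ≤ ((2 * R + 2 : ℕ) : ℝ) := by exact_mod_cast (show 1 ≤ 2 * R + 2 by omega)
    linarith [(Nat.cast_nonneg (d / 2 + 1) : (0 : ℝ) ≤ _)]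
  have hρ0 : ((2 * ((P.L ^ k - 1) / 2 + P.rad k) : ℕ) : ℝ) + (d / 2 + 1 : ℕ) ≤
      (((2 * R + 2 : ℕ) : ℝ) + ((d / 2 + 1 : ℕ) : ℝ)) * P.R k := abkm_box_C0 (d := d) hL k
  -- integration property, from the predicate
  have hint : IntegrationProperty P k D.𝒞 A𝒫' := integrationProperty_of_stepKernelBounds hB hS p r₀ h A
  -- `B_k K` only sees `K(B₀)`; replace `K` by its restriction to connected `k`-polymers
  set K' : Finset (Fin d → ZMod M) → ((Fin d → ZMod M) → ℝ) → ℂ :=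
    fun X => if IsPolymer (L ^ k) X ∧ IsConn X then K X else 0 with hK'def
  have hMo : Odd M := by rw [hM]; exact hLodd.pow
  have hPB : IsPolymer (L ^ k) D.B₀ := by rw [hB₀]; exact isPolymer_blockOf _ x₀
  have hcB : IsConn D.B₀ := by rw [hB₀]; exact TorusPolymer.isConn_blockOf hMo hLodd.pow x₀
  have hK'B : K' D.B₀ = K D.B₀ := by simp only [hK'def, hPB, hcB, and_self, if_true]
  have hopB : opB D K = opB D K' := by unfold opB; rw [hK'B]
  have hK' : WeakNormLE P k K' C := fun X hX hc => by
    have : K' X = K X := by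
      show (if IsPolymer (L ^ k) X ∧ IsConn X then K X else 0) = K X
      exact if_pos ⟨hX, hc⟩
    rw [this]; exact hK X hX hc
  have hK'd : ∀ X, ContDiff ℝ P.r₀ (K' X) := fun X => by
    by_cases hX : IsPolymer (L ^ k) X ∧ IsConn X
    · simp only [hK'def, if_pos hX]; exact hKd X
    · simp only [hK'def, if_neg hX]; exact contDiff_const
  have hK'loc : ∀ X, IsPolymer (P.L ^ k) X → IsConn X → IsGaugeLocal (P.gauge k X) (K' X) :=
    fun X hX hc => by
      have : K' X = K X := by
        show (if IsPolymer (L ^ k) X ∧ IsConn X then K X else 0) = K X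
        exact if_pos ⟨hX, hc⟩
      rw [this]; exact hKloc X hX hc
  have hA0 : 0 < A := by linarith
  have hR'd : ∀ X, ContDiff ℝ P.r₀ (fluct D.𝒞 (K' X)) := fun X => by
    by_cases hX : IsPolymer (L ^ k) X ∧ IsConn X
    · exact contDiff_fluct_of_weakNormLE_of_stepKernelBounds hB hS hA0 hC hK' hK'd hK'loc hX.1 hX.2
    · have : K' X = 0 := by simp only [hK'def, if_neg hX]
      rw [this]
      have h0 : fluct D.𝒞 (0 : ((Fin d → ZMod M) → ℝ) → ℂ) = fun _ => 0 := by
        funext φ; unfold fluct; simp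
      rw [h0]; exact contDiff_const
  -- Lemma 10.6 (abstract) for `K'`
  have hmain := hamNorm_opB_le_succ P hMt hLodd htodd D hB₀ hc₀ h𝔥' h𝔥le hR hRle hr₀' hwrap hroom hC₀
    hρ0 hint hC hK' hK'd hK'loc hR'd hA
  -- bookkeeping: `L^d · |B₀| = L^{d(k+1)}`
  have hcard : D.B₀.card = L ^ (d * k) := by
    rw [hB₀, card_blockOf hMt0 hLodd.pow htodd x₀, ← pow_mul, mul_comm]
  have hn : P.L ^ d * D.B₀.card = L ^ (d * (k + 1)) := by
    show L ^ d * D.B₀.card = L ^ (d * (k + 1))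
    rw [hcard, ← pow_add]; congr 1; ring
  rw [hopB, ← hn]
  exact hmain

/-- The `q = 0` statement `hamNorm_opB_abkm_le` is the case `StepKernelBounds` of the weight kernel
itself (consistency check of the twin). [cite: AdamsBuchholzKoteckyMuller2019, Lemma 10.6] -/
theorem hamNorm_opB_abkm_le_of_stepKernelBounds_self {L N Mord R n p r₀ : ℕ}
    {θbar lam μ δ₁ δ₀ A𝒫 h A : ℝ}
    {𝒞 : ℕ → (Fin d → ZMod M) → ℝ} (hd : 3 ≤ d) (hn : 2 ≤ n) (hLodd : Odd L)
    (hL : 2 ^ (d + 3) + 16 * R ≤ L)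
    (hM : M = L ^ N) {k : ℕ} (hkN : k + 1 ≤ N) (hpM : p + d ≤ Mord) (hMR : Mord ≤ R)
    (hr₀ : 3 ≤ r₀) (hθbar : 0 < θbar) (hlam : 0 < lam)
    (hB : AbkmWeightBounds L N Mord R n θbar lam μ δ₁ δ₀ A𝒫 𝒞
      (abkmWeightData L N Mord R θbar (schedDelta δ₀ δ₁ N) 𝒞))
    {Cα : (Fin d → ℕ) → ℝ}
    (hCα : ∀ j, 1 ≤ j → j ≤ N + 1 → ∀ θ' : Fin d → ℕ, ∑ i, θ' i ≤ n →
      ∀ x, |GradientFRD.iterDiff θ' (𝒞 j) x| ≤ Cα θ' / (L : ℝ) ^ ((j - 1) * (d - 2 + ∑ i, θ' i)))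
    (hh : 0 < h) (hA : 1 ≤ A)
    (D : StepData d M) (hD𝒞 : D.𝒞 = 𝒞 (k + 1)) {x₀ : Fin d → ZMod M} (hB₀ : D.B₀ = blockOf (L ^ k) x₀)
    (hc₀ : D.c₀ = boxCorner (L ^ k) (starRad R L d k) x₀)
    {K : Finset (Fin d → ZMod M) → ((Fin d → ZMod M) → ℝ) → ℂ} {C : ℝ} (hC : 0 ≤ C)
    (hK : WeakNormLE (abkmNormParams L N Mord R p r₀ h θbar A (schedDelta δ₀ δ₁ N) 𝒞) k K C)
    (hKd : ∀ X, ContDiff ℝ r₀ (K X))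
    (hKloc : ∀ X, IsPolymer (L ^ k) X → IsConn X →
      IsGaugeLocal ((abkmNormParams L N Mord R p r₀ h θbar A (schedDelta δ₀ δ₁ N) 𝒞).gauge k X) (K X)) :
    hamNorm (fieldWt h L d (k + 1)) ((L : ℝ) ^ (k + 1)) (L ^ (d * (k + 1))) (opB D K) ≤
      (L : ℝ) ^ d * (pi2BoundConst d (((2 * R + 2 : ℕ) : ℝ) + ((d / 2 + 1 : ℕ) : ℝ)) *
        (C * A𝒫 * A⁻¹)) := by
  have hS := AbkmWeightBounds.stepKernelBounds hθbar hlam hB (by omega) hn hLodd.pos hCα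
    (k := k) (by omega)
  rw [← hD𝒞] at hS
  exact hamNorm_opB_abkm_le_of_stepKernelBounds hd hLodd hL hM hkN hpM hMR hr₀ hB hh hA D hS hB₀ hc₀
    hC hK hKd hKloc

/-! ## `B_k` is additive on the admissible activities, step kernel by predicate -/

/-- **`B_k^{(q)} : M(𝓟_k^c) → M_0(𝓑_{k+1})`, `B_k K = −Π₂ R_{k+1} K(B₀)`, as an additive map on the
admissible activities** of the concrete parameters, for step data whose kernel satisfies
`StepKernelBounds` (`r₀ ≥ 2`, `B₀` a `k`-block): integrability of `K(B₀, φ + ·)` and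
differentiability of `R_{k+1}K(B₀)` follow from the norm bound and the subcriticality margin.
[cite: AdamsBuchholzKoteckyMuller2019, Theorem 6.8 (the operator B_k)] -/
def opBHomQ {L N Mord R n p r₀ : ℕ} {θbar lam μ δ₁ δ₀ A𝒫 A𝒫' C₂ h A : ℝ}
    {𝒞 : ℕ → (Fin d → ZMod M) → ℝ}
    (hB : AbkmWeightBounds L N Mord R n θbar lam μ δ₁ δ₀ A𝒫 𝒞
      (abkmWeightData L N Mord R θbar (schedDelta δ₀ δ₁ N) 𝒞))
    {k : ℕ} (hr₀ : 2 ≤ r₀) (hLodd : Odd L) (hM : M = L ^ N)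
    (D : StepData d M)
    (hS : StepKernelBounds (abkmWeightData L N Mord R θbar (schedDelta δ₀ δ₁ N) 𝒞) L k A𝒫' C₂ D.𝒞)
    {x₀ : Fin d → ZMod M} (hB₀ : D.B₀ = blockOf (L ^ k) x₀) :
    activitySpace (abkmNormParams L N Mord R p r₀ h θbar A (schedDelta δ₀ δ₁ N) 𝒞) k →+
      RelevantHamiltonian ℂ d :=
  AddMonoidHom.mk' (fun K => opB D (K : Finset (Fin d → ZMod M) → ((Fin d → ZMod M) → ℝ) → ℂ))
    (by
      intro K K'
      have hMo : Odd M := by rw [hM]; exact hLodd.pow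
      have hPB : IsPolymer ((abkmNormParams L N Mord R p r₀ h θbar A (schedDelta δ₀ δ₁ N) 𝒞).L ^ k) D.B₀ := by rw [hB₀]; exact isPolymer_blockOf _ x₀
      have hcB : IsConn D.B₀ := by rw [hB₀]; exact TorusPolymer.isConn_blockOf hMo hLodd.pow x₀
      -- the norm bounds of the two activities at `B₀`
      obtain ⟨C, hC⟩ := activitySpace.exists_weakNormLE K
      obtain ⟨C', hC'⟩ := activitySpace.exists_weakNormLE K'
      have hCn : 0 ≤ C * (abkmNormParams L N Mord R p r₀ h θbar A (schedDelta δ₀ δ₁ N) 𝒞).aFactor k D.B₀ := by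
        have h1 := (hC D.B₀ hPB hcB) 0
        exact (mul_nonneg_iff_of_pos_right ((abkmNormParams L N Mord R p r₀ h θbar A (schedDelta δ₀ δ₁ N) 𝒞).W.weight_pos k D.B₀ 0)).1 ((tayNorm_nonneg _ _ _ _).trans h1)
      have hC'n : 0 ≤ C' * (abkmNormParams L N Mord R p r₀ h θbar A (schedDelta δ₀ δ₁ N) 𝒞).aFactor k D.B₀ := by
        have h1 := (hC' D.B₀ hPB hcB) 0
        exact (mul_nonneg_iff_of_pos_right ((abkmNormParams L N Mord R p r₀ h θbar A (schedDelta δ₀ δ₁ N) 𝒞).W.weight_pos k D.B₀ 0)).1 ((tayNorm_nonneg _ _ _ _).trans h1)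
      have hdom := hS.weightSectionDominated hB.dominated D.B₀ ((abkmNormParams L N Mord R p r₀ h θbar A (schedDelta δ₀ δ₁ N) 𝒞).gauge k D.B₀)
      have hiK : ∀ φ, Integrable (fun ξ => (K : (Finset (Fin d → ZMod M) → ((Fin d → ZMod M) → ℝ) → ℂ)) D.B₀ (φ + ξ)) (stepMeasure D.𝒞) :=
        fun φ => integrable_comp_add_of_tayNormLE (hC D.B₀ hPB hcB) hCn (activitySpace.contDiff K _)
            (activitySpace.isGaugeLocal K hPB hcB) hdom φ
      have hiK' : ∀ φ, Integrable (fun ξ => (K' : (Finset (Fin d → ZMod M) → ((Fin d → ZMod M) → ℝ) → ℂ)) D.B₀ (φ + ξ)) (stepMeasure D.𝒞) :=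
        fun φ => integrable_comp_add_of_tayNormLE (hC' D.B₀ hPB hcB) hC'n (activitySpace.contDiff K' _)
            (activitySpace.isGaugeLocal K' hPB hcB) hdom φ
      have hdK : ContDiff ℝ 2 (fluct D.𝒞 ((K : (Finset (Fin d → ZMod M) → ((Fin d → ZMod M) → ℝ) → ℂ)) D.B₀)) :=
        (hS.contDiff_fluct hB.dominated D.B₀ ((abkmNormParams L N Mord R p r₀ h θbar A (schedDelta δ₀ δ₁ N) 𝒞).gauge k D.B₀) hCn (activitySpace.contDiff K _)
          (activitySpace.isGaugeLocal K hPB hcB) (hC D.B₀ hPB hcB)).of_le (by exact_mod_cast hr₀)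
      have hdK' : ContDiff ℝ 2 (fluct D.𝒞 ((K' : (Finset (Fin d → ZMod M) → ((Fin d → ZMod M) → ℝ) → ℂ)) D.B₀)) :=
        (hS.contDiff_fluct hB.dominated D.B₀ ((abkmNormParams L N Mord R p r₀ h θbar A (schedDelta δ₀ δ₁ N) 𝒞).gauge k D.B₀) hC'n (activitySpace.contDiff K' _)
          (activitySpace.isGaugeLocal K' hPB hcB) (hC' D.B₀ hPB hcB)).of_le (by exact_mod_cast hr₀)
      show opB D ((K + K' : activitySpace (abkmNormParams L N Mord R p r₀ h θbar A (schedDelta δ₀ δ₁ N) 𝒞) k) : (Finset (Fin d → ZMod M) → ((Fin d → ZMod M) → ℝ) → ℂ)) =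
        opB D (K : (Finset (Fin d → ZMod M) → ((Fin d → ZMod M) → ℝ) → ℂ)) + opB D (K' : (Finset (Fin d → ZMod M) → ((Fin d → ZMod M) → ℝ) → ℂ))
      rw [Submodule.coe_add]
      unfold opB
      rw [Pi.add_apply, fluct_add_of_integrable hiK hiK', Pi2_add_of_contDiff _ _ hdK hdK', neg_add])

/-- `opBHomQ` is `B_k`. [cite: AdamsBuchholzKoteckyMuller2019, Theorem 6.8 (the operator B_k)] -/
theorem opBHomQ_apply {L N Mord R n p r₀ : ℕ} {θbar lam μ δ₁ δ₀ A𝒫 A𝒫' C₂ h A : ℝ}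
    {𝒞 : ℕ → (Fin d → ZMod M) → ℝ}
    (hB : AbkmWeightBounds L N Mord R n θbar lam μ δ₁ δ₀ A𝒫 𝒞
      (abkmWeightData L N Mord R θbar (schedDelta δ₀ δ₁ N) 𝒞))
    {k : ℕ} (hr₀ : 2 ≤ r₀) (hLodd : Odd L) (hM : M = L ^ N)
    (D : StepData d M)
    (hS : StepKernelBounds (abkmWeightData L N Mord R θbar (schedDelta δ₀ δ₁ N) 𝒞) L k A𝒫' C₂ D.𝒞)
    {x₀ : Fin d → ZMod M} (hB₀ : D.B₀ = blockOf (L ^ k) x₀)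
    (K : activitySpace (abkmNormParams L N Mord R p r₀ h θbar A (schedDelta δ₀ δ₁ N) 𝒞) k) :
    opBHomQ (p := p) (r₀ := r₀) (h := h) (A := A) hB hr₀ hLodd hM D hS hB₀ K =
      opB D (K : Finset (Fin d → ZMod M) → ((Fin d → ZMod M) → ℝ) → ℂ) := by
  simp only [opBHomQ, AddMonoidHom.mk'_apply]

end Literature.MathematicalPhysics.StatisticalMechanics.GradientRG

end
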